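import Summits.QuantumFields.YangMills.Theorems.UnitScaleTiltProp7QTwSScalarSector
import Summits.QuantumFields.YangMills.Theorems.UnitScaleTiltProp7CmapTwSymInputs
import Summits.QuantumFields.YangMills.Theorems.UnitScaleTiltProp7SymAvgGLSmallOfRegPr
import HarnessLib

/-!
# Route `UnitScaleTilt`, crux K1 child «MinimiserStabilityRegPr» (stmt-QuantumFields-19200), stub `stub_existenceMinimalOrbit` (EX), the (R) reality rows of the EX knit —
# **(Q-b) DISCHARGED ON PRINT'S REGULAR SPACE `𝔘_k(ε₀)`**: at every printed-regular background `U₀` (`RegPr F n K ε₀ U₀`, window `10¹²L³ε₀ ≤ 1`) print's averaging operator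
# `Q(U₀) = QTwS U₀` maps the scalar bond field `c·1` to the scalar block field `(L^{K−n}·(Q_{K−n} c)(ĉ))·1` — the three displayed clauses of ✓`QTwS_apply_smul_one`
# (`hd`: differentiability of the twisted log-chart at `0`; `hbg`: the (0.4) loop variables of the background tower; `hδ`: those of the scalar tower of `e^{tc}`) SUPPLIED BY NAME
# from ✓`Prop7CmapTwSymInputs.analyticOnNhd_logChartTwS`, ✓`IterPlaqSmallAllL.plaqSmall_iter_T3_allL` + ✓`LatticeWordStokes.dist1_loopHol_le`, and ★w8-19200's abelian tower
# ✓`Prop8ChartDoubleBar.dbarIterU_coe_eq_exp_abelian`; whence ym-inputs-p03 g2's displayed row (Q-b)ʳ `hscR` of ✓`Prop7QTwSRealitySectors` VERBATIM (`QTwS_smul_one_real_of_regPr`).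

Cell `ym3-torus`, width seat `ym-ust-20520-w5` (gen 5).  `--supports stmt-QuantumFields-19200 --as helper`; THEOREMS ONLY (0 `def`, 0 `sorry`); count-neutral; nothing here claims
the stub, the crux, d = 4 or the mass gap — YM₃ on T³ is a ladder rung (R3), not the Clay problem.

WHAT IS PROVED (`k := K − n`, `ℓ := (d+2)L`, `ĉ := bondShift (sites_eq F n K h) c`).
* §1 (generic `Params`, `𝔸 = ℂ`) `norm_holT_sub_one_le_of_exp` (`‖hol(e^{w}) − 1‖ ≤ 2·|walk|·s` for `|w| ≤ s`, `|walk|·s ≤ 1`), ★`abelianTower_small` — for `|z(b)| ≤ t` and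
  `32ℓ·Lᵏ·t ≤ 1`, every (0.4) loop variable of every level `j < k` of the abelian double-bar tower `U̿^{(j)}(e^{iz})` is within `1∕8` of `1` and every stair transporter within `1`
  (closed form `U̿^{(j)}(e^{iz})(b) = exp(i·Lʲ·(Q_j z)(b))`, `|Lʲ(Q_j z)(b)| ≤ Lʲt`, words of `≤ ℓ` letters, `|e^{s} − 1| ≤ 2|s|`).
* §2 (T³) `loop_budget_eighth` (`(ℓ²∕4)·(10800L+1)·L^{2j}ε₀L^{−2k} ≤ 1∕8` under `10⁷L³ε₀ ≤ 1`), ★`loopHolU_emlIterU_bgUnits_le_eighth_of_regPr` (= `hbg` at `U₀ ∈ 𝔘_k(ε₀)`: the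
  background tower IS the route's `SU(2)` tower ✓`coe_iter_eq_emlIterU_of_regPr`, whose plaquettes are small at every level ✓`plaqSmall_iter_T3_allL`, Stokes ✓`dist1_loopHol_le`),
  ★`scalarTower_small_T3` (= `hδ`, from §1 at `z := −i·t·c`, `δ := (32ℓLᵏ(Σ_b|c(b)| + 1))⁻¹`), `differentiableAt_logChartTwS_of_regPr` (= `hd`, ✓`analyticOnNhd_logChartTwS` at `e := (10⁹L²)⁻¹`).
* §3 ★★★`QTwS_apply_smul_one_of_regPr (hε₀) (hWε : 10¹²L³ε₀ ≤ 1) (U₀) (hreg) (c) : QTwS F n K h U₀ (fun b => c b • 1) = fun B => ((L : ℂ)^k · (bondAvgIter k c)(B̂)) • 1`;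
  ★★★`QTwS_smul_one_real_of_regPr` — `∀ r : PBond (F.P K) 0 → ℝ, ∃ s : PBond (F.P n) 0 → ℝ, QTwS U₀ (fun b => ((r b : ℝ) : ℂ) • 1) = fun c => ((s c : ℝ) : ℂ) • 1` (p03 g2's `hscR`,
  witness `s := Lᵏ·(Q_k r)(ĉ)` — real averaging weights, ✓`ChartHInv.bondAvgIter_comp_apply` at `Complex.ofRealCLM`); `QTwS_smul_one_eq_QTwS_one_of_regPr` ((J2): the value at `U₀ = 1`),
  `star_QTwS_smul_one_of_regPr` (`Q(σ(c·1)) = σ(Q(c·1))`).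
HONEST SCOPE.  Composition of landed theorems; the only analytic inputs are the cited landed files; nothing of [Balaban1985Averaging]∕[Balaban1985BackgroundPropagators] is asserted;
the window `10¹²L³ε₀ ≤ 1` is ✓`Prop7CmapTwSymInputs`'s (the loop budget alone needs `10⁷L³ε₀ ≤ 1`).

References: T. Bałaban, CMP **98** (1985) 17–51 [Balaban1985Averaging] ((19)–(20) p.21, (89)–(92) p.31, (125)–(127) p.36, Prop. 4 (134)–(135) p.38); CMP **99** (1985) 389–434
[Balaban1985BackgroundPropagators] ((3.13)–(3.15) p.393); CMP **95** (1984) 17–40 [Balaban1984PropagatorsI] ((1.8) p.19, (1.18) p.20); CMP **102** (1985) 277–309 [Balaban1985Variational]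
((51) p.286, (146) p.301); CMP **109** (1987) 249–301 [Balaban1987RG1] ((0.3)–(0.4) pp.252–253).
-/

set_option autoImplicit false

noncomputable section

open scoped Matrix.Norms.L2Operator
open Filter Topology Metric

namespace Summit.QuantumFields.YangMills.Theorems.Prop7SymAvgTwSym

open NormedSpace
open Literature.MathematicalPhysics.QuantumFieldTheory.Balaban1983to89
open T4Continuum BlockAveraging AveragingRT ExpMeanLog MatrixLog BlockAveragingEMLLinearised LatticeFieldCalculus
open LatticeWordStokes (length_loopWord_le dist1_loopHol_le)
open FederbushMean (dist1_SU_eq)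
open B10Eq27TorusAxialLog (holT unitsField toUField)
open B7Prop1Explicit (expUnit val_expUnit)
open T3ContinuumYM3Torus
open T3LevelShift (bondShift)
open T3PrintedRegularOrbits (sites_eq)
open T3RegularMinimiser (regThreshold)
open T3PrintedRegularMinimiser (RegPr)
open T3SectALandauChart (eta eta_pos bgUnits)
open Summit.QuantumFields.YangMills.Theorems.Prop8Chart (loopHolU emlIterU expCfg coe_expCfg coe_loopHolU_unitsField)
open Summit.QuantumFields.YangMills.Theorems.Prop8ChartDoubleBar (dbarIterU dbarIterU_coe_eq_exp_abelian holT_coe_eq_exp_walkSum norm_walkSum_le_of_steps)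
open Summit.QuantumFields.YangMills.Theorems.Prop7CmapTwSymInputs (analyticOnNhd_logChartTwS)
open Summit.QuantumFields.YangMills.Theorems.Prop7SymAvgGLSmallOfRegPr (coe_iter_eq_emlIterU_of_regPr bgUnits_eq)
open Summit.QuantumFields.YangMills.Theorems.IterPlaqSmallAllL (plaqSmall_iter_T3_allL)
open Literature.MathematicalPhysics.QuantumFieldTheory.BalabanImbrieJaffe1984to88.BIJ85ContourLocality (norm_bondAvgIter_le_tower)

/-! ## §1 The abelian double-bar tower of `e^{iz}` has small loop variables and stairs -/

section Abelian

variable {P : Params}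

/-- **`‖hol(e^{w}) − 1‖ ≤ 2·|walk|·s`** for a `ℂˣ`-field `S = e^{w}` with `|w(b)| ≤ s` along a walk with `|walk|·s ≤ 1` (✓`holT_coe_eq_exp_walkSum`, `|Σ±w| ≤ |walk|·s`, `|e^{x} − 1| ≤ 2|x|`).
[cite: Balaban1984PropagatorsI, (1.8) p.19] -/
theorem norm_holT_sub_one_le_of_exp {j : ℕ} (S : GaugeField P j ℂˣ) (w : PBond P j → ℂ) {s : ℝ}
    (hS : ∀ b, ((S b : ℂˣ) : ℂ) = Complex.exp (w b)) (hw : ∀ b, ‖w b‖ ≤ s)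
    (x : Site P j) (word : List (Letter P.d)) (hlen : ((walk x word).length : ℝ) * s ≤ 1) :
    ‖((holT S x word : ℂˣ) : ℂ) - 1‖ ≤ 2 * (((walk x word).length : ℝ) * s) := by
  rw [holT_coe_eq_exp_walkSum S w x word (fun st _ => hS st.bond)]
  have h1 : ‖walkSum w (walk x word)‖ ≤ ((walk x word).length : ℝ) * s :=
    norm_walkSum_le_of_steps w (walk x word) (fun st _ => hw st.bond)
  exact (Complex.norm_exp_sub_one_le (h1.trans hlen)).trans (by linarith)

/-- ★ **THE SCALAR TOWER OF `e^{iz}` IS `1∕8`-SMALL ON ITS LOOPS AND `1`-SMALL ON ITS STAIRS** at every level `j < k`, for `|z(b)| ≤ t`, `32ℓ·Lᵏ·t ≤ 1` (`ℓ = (d+2)L` bounds every loop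
and stair word): the closed form ✓`dbarIterU_coe_eq_exp_abelian` (`U̿^{(j)}(e^{iz})(b) = exp(i·Lʲ·(Q_j z)(b))`, `|(Q_j z)(b)| ≤ t` by ✓`norm_bondAvgIter_le_tower`) and
`norm_holT_sub_one_le_of_exp`. [cite: Balaban1985Averaging, Prop. 4 (134)-(135) p.38; Balaban1984PropagatorsI, (1.18) p.20; Balaban1987RG1, (0.3)-(0.4) pp.252-253] -/
theorem abelianTower_small {k : ℕ} (hk : k ≤ P.m + P.K) (z : PBond P 0 → ℂ) {t : ℝ} (ht0 : 0 ≤ t)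
    (hsmall : 32 * ((((P.d + 2) * P.L : ℕ) : ℝ)) * ((P.L : ℝ) ^ k * t) ≤ 1) (hz : ∀ b, ‖z b‖ ≤ t) :
    (∀ j, j < k → ∀ (e : PBond P (j + 1)) (i : Idx P),
        ‖((loopHolU (dbarIterU j (expCfg (𝔸 := ℂ) 1 z)) e i : ℂˣ) : ℂ) - 1‖ ≤ 1 / 8) ∧
    (∀ j, j < k → ∀ (y : Site P (j + 1)) (i : Idx P),
        ‖((holT (dbarIterU j (expCfg (𝔸 := ℂ) 1 z)) (emb y) (stairWord i.2.1 (off i.1)) : ℂˣ) : ℂ) - 1‖ < 1) := by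
  set ℓ : ℝ := (((P.d + 2) * P.L : ℕ) : ℝ) with hℓ
  have hL1 : (1 : ℝ) ≤ P.L := by exact_mod_cast P.L_pos
  have hℓ0 : 0 ≤ ℓ := by rw [hℓ]; positivity
  have hLk0 : 0 ≤ (P.L : ℝ) ^ k * t := by positivity
  -- every level `j < k`: the closed form, the exponents `w_j(b) = i·Lʲ·(Q_j z)(b)` of size `≤ Lᵏ·t`, the words
  have key : ∀ j, j < k → ∀ (x : Site P j) (word : List (Letter P.d)), (walk x word).length ≤ (P.d + 2) * P.L →
      ‖((holT (dbarIterU j (expCfg (𝔸 := ℂ) 1 z)) x word : ℂˣ) : ℂ) - 1‖ ≤ 1 / 16 := by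
    intro j hj x word hlen
    have hjk : j ≤ P.m + P.K := by omega
    have hpow : (P.L : ℝ) ^ j ≤ (P.L : ℝ) ^ k := pow_le_pow_right₀ hL1 hj.le
    have hLj0 : 0 ≤ (P.L : ℝ) ^ j * t := by positivity
    have hLjk : (P.L : ℝ) ^ j * t ≤ (P.L : ℝ) ^ k * t := mul_le_mul_of_nonneg_right hpow ht0
    have hsj : 2 * ℓ * (|(1 : ℝ)| * (P.L : ℝ) ^ j * t) ≤ 1 := by
      rw [abs_one, one_mul]
      nlinarith [mul_le_mul_of_nonneg_left hLjk hℓ0]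
    set w : PBond P j → ℂ := fun b => (Complex.I * ((1 : ℝ) : ℂ)) * (((P.L : ℂ)) ^ j * bondAvgIter j z b) with hw
    have hS : ∀ b : PBond P j, ((dbarIterU j (expCfg (𝔸 := ℂ) 1 z) b : ℂˣ) : ℂ) = Complex.exp (w b) := fun b =>
      dbarIterU_coe_eq_exp_abelian (P := P) 1 j hjk Set.univ z t ht0 hsj (fun b _ _ => hz b) b (Set.mem_univ _) (Set.mem_univ _)
    have hwb : ∀ b : PBond P j, ‖w b‖ ≤ (P.L : ℝ) ^ j * t := fun b => by
      have hQ : ‖bondAvgIter j z b‖ ≤ t :=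
        norm_bondAvgIter_le_tower j hjk Set.univ z t (fun b' _ _ => hz b') b (Set.mem_univ _) (Set.mem_univ _)
      rw [hw]
      dsimp only
      rw [norm_mul, norm_mul, Complex.norm_I, one_mul, Complex.ofReal_one, norm_one, one_mul, norm_mul, norm_pow, Complex.norm_natCast]
      exact mul_le_mul_of_nonneg_left hQ (by positivity)
    have hlenr : ((walk x word).length : ℝ) ≤ ℓ := by rw [hℓ]; exact_mod_cast hlen
    have hprod : ((walk x word).length : ℝ) * ((P.L : ℝ) ^ j * t) ≤ ℓ * ((P.L : ℝ) ^ k * t) :=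
      mul_le_mul hlenr hLjk hLj0 hℓ0
    have hℓk : ℓ * ((P.L : ℝ) ^ k * t) ≤ 1 / 32 := by nlinarith
    have h1 : ((walk x word).length : ℝ) * ((P.L : ℝ) ^ j * t) ≤ 1 := by linarith
    have h2 := norm_holT_sub_one_le_of_exp (dbarIterU j (expCfg (𝔸 := ℂ) 1 z)) w hS hwb x word h1
    linarith
  refine ⟨fun j hj e i => ?_, fun j hj y i => ?_⟩
  · have h := key j hj (emb e.src) (loopWord P.L e.dir (off i.1) i.2.1 i.2.2) ((length_walk _ _).le.trans (length_loopWord_le e i))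
    show ‖((holT (dbarIterU j (expCfg (𝔸 := ℂ) 1 z)) (emb e.src) (loopWord P.L e.dir (off i.1) i.2.1 i.2.2) : ℂˣ) : ℂ) - 1‖ ≤ 1 / 8
    linarith
  · have h := key j hj (emb y) (stairWord i.2.1 (off i.1)) (length_walk_stairWord_le _ _ _)
    linarith

end Abelian

/-! ## §2 The three displayed clauses of `QTwS_apply_smul_one` at a printed-regular background -/

section T3

variable (F : T3Family) {n K : ℕ} (h : n ≤ K)

/-- **THE LOOP BUDGET AT THE d = 3 CARRIER, `1∕8` FORM**: for `j ≤ K − n` and `10⁷·L³·ε₀ ≤ 1`, `(((d+2)L)²∕4)·((10800L+1)·(L^{2j}·ε₀L^{−2(K−n)})) ≤ 1∕8`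
(`L^{2j}·ε₀L^{−2(K−n)} ≤ ε₀`, `(25L²∕4)(10800L+1)ε₀ ≤ 67507·L³ε₀`; the arithmetic of ✓`guard_budget_T3`). [cite: Balaban1985Variational, (146) p.301] -/
theorem loop_budget_eighth (n K : ℕ) {ε₀ : ℝ} (hε₀ : 0 < ε₀) (hε : 10 ^ 7 * (F.L : ℝ) ^ 3 * ε₀ ≤ 1) {s : ℕ} (hs : s ≤ K - n) :
    ((((F.P K).d + 2) * (F.P K).L : ℕ) : ℝ) ^ 2 / 4 * ((10800 * (F.L : ℝ) + 1) * ((F.L : ℝ) ^ (2 * s) * regThreshold F n K ε₀)) ≤ 1 / 8 := by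
  have hd : (F.P K).d = 3 := T3Family.P_d F K
  have hLL : ((F.P K).L : ℝ) = F.L := rfl
  have hL3 : 3 ≤ F.L := by obtain ⟨a, ha⟩ := F.hL.1; have := F.hL.2; omega
  have hL3r : (3 : ℝ) ≤ F.L := by exact_mod_cast hL3
  have hL0 : (0 : ℝ) < F.L := by linarith
  set X : ℝ := (F.L : ℝ) ^ (2 * s) * regThreshold F n K ε₀ with hX
  have hX0 : 0 ≤ X := by rw [hX]; unfold regThreshold; positivity
  have hXε : X ≤ ε₀ := by
    rw [hX]
    unfold regThreshold
    have hle : (F.L : ℝ) ^ (2 * s) ≤ (F.L : ℝ) ^ (2 * (K - n)) := pow_le_pow_right₀ (by linarith) (by omega)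
    have hpos : (0 : ℝ) < (F.L : ℝ) ^ (2 * (K - n)) := by positivity
    rw [inv_pow, show (F.L : ℝ) ^ (2 * s) * (ε₀ * ((F.L : ℝ) ^ (2 * (K - n)))⁻¹) = ε₀ * ((F.L : ℝ) ^ (2 * s) / (F.L : ℝ) ^ (2 * (K - n))) by ring]
    calc ε₀ * ((F.L : ℝ) ^ (2 * s) / (F.L : ℝ) ^ (2 * (K - n))) ≤ ε₀ * 1 :=
          mul_le_mul_of_nonneg_left ((div_le_one hpos).2 hle) hε₀.le
      _ = ε₀ := mul_one _
  rw [hd]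
  push_cast
  rw [hLL]
  have h1 : (F.L : ℝ) ^ 2 * (10800 * (F.L : ℝ) + 1) * X ≤ (F.L : ℝ) ^ 2 * (10800 * (F.L : ℝ) + 1) * ε₀ :=
    mul_le_mul_of_nonneg_left hXε (by positivity)
  have h2 : (F.L : ℝ) ^ 2 * ε₀ ≤ (F.L : ℝ) ^ 3 * ε₀ :=
    mul_le_mul_of_nonneg_right (pow_le_pow_right₀ (by linarith) (by norm_num)) hε₀.le
  nlinarith [h1, h2, hX0, mul_nonneg (sq_nonneg (F.L : ℝ)) hX0]

/-- ★ **`hbg` AT `U₀ ∈ 𝔘_k(ε₀)`**: the (0.4) loop variables of every level `j < K − n` of the background tower `Ū₀♭ʲ = emlIterU j (bgUnits F K U₀)` are within `1∕8` of `1` — the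
units-field tower IS the route's `SU(2)` tower (✓`coe_iter_eq_emlIterU_of_regPr`), whose plaquette variables are `(10800L+1)·L^{2j}ε₀L^{−2k}`-small (✓`plaqSmall_iter_T3_allL`), and
Stokes over the `≤ ((d+2)L)²∕4` plaquettes of a loop (✓`dist1_loopHol_le`); window `10⁷L³ε₀ ≤ 1`. [cite: Balaban1985Averaging, (19)-(20) p.21; Balaban1985Variational, (146) p.301;
Balaban1987RG1, (0.4) p.253] -/
theorem loopHolU_emlIterU_bgUnits_le_eighth_of_regPr {ε₀ : ℝ} (hε₀ : 0 < ε₀) (hε : 10 ^ 7 * (F.L : ℝ) ^ 3 * ε₀ ≤ 1)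
    {U₀ : GaugeField (F.P K) 0 (Matrix.specialUnitaryGroup (Fin 2) ℂ)} (hreg : RegPr F n K ε₀ U₀) :
    ∀ j, j < K - n → ∀ (e : PBond (F.P K) (j + 1)) (i : Idx (F.P K)),
      ‖((loopHolU (emlIterU j (bgUnits F K U₀)) e i : (Matrix (Fin 2) (Fin 2) ℂ)ˣ) : Matrix (Fin 2) (Fin 2) ℂ) - 1‖ ≤ 1 / 8 := by
  intro j hj e i
  have hjle : j ≤ K - n := hj.le
  rw [bgUnits_eq, ← coe_iter_eq_emlIterU_of_regPr F n K hε₀ hε hreg hjle, coe_loopHolU_unitsField, ← dist1_SU_eq]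
  have ht0 : 0 ≤ (10800 * (F.L : ℝ) + 1) * ((F.L : ℝ) ^ (2 * j) * regThreshold F n K ε₀) := by unfold regThreshold; positivity
  exact (dist1_loopHol_le ht0 (plaqSmall_iter_T3_allL F n K hε₀ hε U₀ hreg.plaqSmall j hjle) e i).trans (loop_budget_eighth F n K hε₀ hε hjle)

/-- ★ **`hδ`**: for every `c` there is `δ > 0` (`δ := (32ℓLᵏ(Σ_b |c(b)| + 1))⁻¹`) such that for `|t| < δ` the scalar tower of `e^{tc} = expCfg 1 (−i·t·c)` is `1∕8`-small on its loops
and `1`-small on its stairs at every level `< K − n` (§1 `abelianTower_small`). [cite: Balaban1985Averaging, Prop. 4 (134)-(135) p.38; Balaban1984PropagatorsI, (1.18) p.20] -/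
theorem scalarTower_small_T3 (c : PBond (F.P K) 0 → ℂ) :
    ∃ δ : ℝ, 0 < δ ∧ ∀ t : ℂ, ‖t‖ < δ →
      (∀ j, j < K - n → ∀ (e : PBond (F.P K) (j + 1)) (i : Idx (F.P K)),
        ‖((loopHolU (dbarIterU j (fun b => expUnit (t * c b))) e i : ℂˣ) : ℂ) - 1‖ ≤ 1 / 8) ∧
      (∀ j, j < K - n → ∀ (y : Site (F.P K) (j + 1)) (i : Idx (F.P K)),
        ‖((holT (dbarIterU j (fun b => expUnit (t * c b))) (emb y) (stairWord i.2.1 (off i.1)) : ℂˣ) : ℂ) - 1‖ < 1) := by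
  have hk : K - n ≤ (F.P K).m + (F.P K).K := by show K - n ≤ F.m + K; omega
  set ℓ : ℝ := ((((F.P K).d + 2) * (F.P K).L : ℕ) : ℝ) with hℓ
  set M : ℝ := ∑ b, ‖c b‖ with hM
  have hM0 : 0 ≤ M := by rw [hM]; exact Finset.sum_nonneg fun b _ => norm_nonneg _
  have hcM : ∀ b, ‖c b‖ ≤ M := fun b => by
    rw [hM]; exact Finset.single_le_sum (f := fun b => ‖c b‖) (fun b _ => norm_nonneg _) (Finset.mem_univ b)
  have hL1 : (1 : ℝ) ≤ (F.P K).L := by exact_mod_cast (F.P K).L_pos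
  have hℓ0 : 0 < ℓ := by
    rw [hℓ]
    have h1 : 1 ≤ ((F.P K).d + 2) * (F.P K).L := le_trans (Nat.succ_le_of_lt (F.P K).L_pos) (Nat.le_mul_of_pos_left _ (by omega))
    exact_mod_cast h1
  set D : ℝ := 32 * ℓ * ((((F.P K).L : ℝ)) ^ (K - n) * (M + 1)) with hD
  have hD0 : 0 < D := by positivity
  refine ⟨D⁻¹, inv_pos.2 hD0, fun t ht => ?_⟩
  -- the exponents `z := −i·t·c`, `|z(b)| ≤ |t|·(M+1) =: t'`, `32ℓLᵏt' ≤ 1`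
  set z : PBond (F.P K) 0 → ℂ := fun b => -Complex.I * t * c b with hz
  have hzb : ∀ b, ‖z b‖ ≤ ‖t‖ * (M + 1) := fun b => by
    rw [hz]
    dsimp only
    rw [norm_mul, norm_mul, norm_neg, Complex.norm_I, one_mul]
    exact mul_le_mul_of_nonneg_left ((hcM b).trans (by linarith)) (norm_nonneg t)
  have ht' : 0 ≤ ‖t‖ * (M + 1) := by positivity
  have hsmall : 32 * ℓ * ((((F.P K).L : ℝ)) ^ (K - n) * (‖t‖ * (M + 1))) ≤ 1 := by
    have h1 : ‖t‖ * D ≤ D⁻¹ * D := mul_le_mul_of_nonneg_right ht.le hD0.le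
    rw [inv_mul_cancel₀ hD0.ne'] at h1
    calc 32 * ℓ * ((((F.P K).L : ℝ)) ^ (K - n) * (‖t‖ * (M + 1))) = ‖t‖ * D := by rw [hD]; ring
      _ ≤ 1 := h1
  have hexp : expCfg (𝔸 := ℂ) 1 z = fun b => expUnit (t * c b) := by
    rw [expCfg_one_eq_expUnit]
    funext b
    rw [hz]
    dsimp only
    rw [show Complex.I * (-Complex.I * t * c b) = -(Complex.I * Complex.I) * t * c b by ring, Complex.I_mul_I, neg_neg, one_mul]
  have key := abelianTower_small (P := F.P K) hk z ht' hsmall hzb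
  rw [hexp] at key
  exact key

/-- **`hd` AT `U₀ ∈ 𝔘_k(ε₀)`**: the re-based twisted log-chart is differentiable at `0` (✓`analyticOnNhd_logChartTwS` on the ball of radius `e·η` at `e := (10⁹L²)⁻¹`; window `10¹²L³ε₀ ≤ 1`).
[cite: Balaban1985BackgroundPropagators, (3.13)-(3.14) p.393; Balaban1985Averaging, Prop. 4 p.38, p.42] -/
theorem differentiableAt_logChartTwS_of_regPr {ε₀ : ℝ} (hε₀ : 0 < ε₀) (hWε : 10 ^ 12 * (F.L : ℝ) ^ 3 * ε₀ ≤ 1)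
    (U₀ : GaugeField (F.P K) 0 (Matrix.specialUnitaryGroup (Fin 2) ℂ)) (hreg : RegPr F n K ε₀ U₀) :
    DifferentiableAt ℂ (logChartTwS F n K h U₀) 0 := by
  have hL3 : 3 ≤ F.L := by obtain ⟨a, ha⟩ := F.hL.1; have := F.hL.2; omega
  have hL0 : (0 : ℝ) < F.L := by exact_mod_cast (show 0 < F.L by omega)
  set e : ℝ := (10 ^ 9 * (F.L : ℝ) ^ 2)⁻¹ with he
  have hpos : (0 : ℝ) < 10 ^ 9 * (F.L : ℝ) ^ 2 := by positivity
  have he0 : 0 < e := by rw [he]; exact inv_pos.2 hpos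
  have hWe : 10 ^ 9 * (F.L : ℝ) ^ 2 * e ≤ 1 := by rw [he, mul_inv_cancel₀ hpos.ne']
  have h0 : (0 : PBond (F.P K) 0 → Matrix (Fin 2) (Fin 2) ℂ) ∈ ball (0 : PBond (F.P K) 0 → Matrix (Fin 2) (Fin 2) ℂ) (e * eta F n K) :=
    mem_ball_self (mul_pos he0 (eta_pos F n K))
  exact ((analyticOnNhd_logChartTwS F h hε₀ he0 hWe hWε U₀ hreg) 0 h0).differentiableAt

/-! ## §3 (Q-b) on `𝔘_k(ε₀)` -/

/-- ★★★ **(Q-b) ON PRINT'S REGULAR SPACE — `Q(U₀)` ON THE CENTRE IS THE FLAT AVERAGE, UNCONDITIONALLY AT `U₀ ∈ 𝔘_k(ε₀)`** (`RegPr F n K ε₀ U₀`, `10¹²L³ε₀ ≤ 1`):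
`QTwS F n K h U₀ (c·1) = fun B => (L^{K−n}·(Q_{K−n} c)(B̂))·1` — ✓`QTwS_apply_smul_one` with its three clauses supplied by §2.
[cite: Balaban1985BackgroundPropagators, (3.14)-(3.15) p.393; Balaban1985Averaging, (125)-(127) p.36; Balaban1984PropagatorsI, (1.18) p.20; Balaban1985Variational, (146) p.301] -/
theorem QTwS_apply_smul_one_of_regPr {ε₀ : ℝ} (hε₀ : 0 < ε₀) (hWε : 10 ^ 12 * (F.L : ℝ) ^ 3 * ε₀ ≤ 1)
    (U₀ : GaugeField (F.P K) 0 (Matrix.specialUnitaryGroup (Fin 2) ℂ)) (hreg : RegPr F n K ε₀ U₀) (c : PBond (F.P K) 0 → ℂ) :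
    QTwS F n K h U₀ (fun b => c b • (1 : Matrix (Fin 2) (Fin 2) ℂ)) =
      fun B => ((((F.P K).L : ℂ)) ^ (K - n) * bondAvgIter (K - n) c (bondShift (sites_eq F n K h) B)) • (1 : Matrix (Fin 2) (Fin 2) ℂ) := by
  have hε7 : 10 ^ 7 * (F.L : ℝ) ^ 3 * ε₀ ≤ 1 := by
    have h1 : (0 : ℝ) ≤ (F.L : ℝ) ^ 3 * ε₀ := by positivity
    nlinarith
  exact QTwS_apply_smul_one F h U₀ c (differentiableAt_logChartTwS_of_regPr F h hε₀ hWε U₀ hreg)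
    (loopHolU_emlIterU_bgUnits_le_eighth_of_regPr F hε₀ hε7 hreg) (scalarTower_small_T3 F c)

/-- ★★★ **(Q-b)ʳ — ym-inputs-p03 g2's DISPLAYED ROW `hscR` OF ✓`Prop7QTwSRealitySectors`, VERBATIM, AT `U₀ ∈ 𝔘_k(ε₀)`**: `QTwS U₀` maps every REAL scalar bond field `r·1` to a REAL
scalar block field — witness `s(c) := L^{K−n}·(Q_{K−n} r)(ĉ)` (the flat average has real weights: ✓`ChartHInv.bondAvgIter_comp_apply` at `ℝ ↪ ℂ`).  Feeds
✓`QTwS_star_comm_of_regPr_of_realScalar` (⟹ ★w4-20520 g4's `hQ`) and ✓`QTwS_scalar_of_realScalar` (`hQsc`) with no adapter.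
[cite: Balaban1985Variational, (51) p.286; Balaban1985BackgroundPropagators, (3.13)-(3.14) p.393; Balaban1984PropagatorsI, (1.18) p.20] -/
theorem QTwS_smul_one_real_of_regPr {ε₀ : ℝ} (hε₀ : 0 < ε₀) (hWε : 10 ^ 12 * (F.L : ℝ) ^ 3 * ε₀ ≤ 1)
    (U₀ : GaugeField (F.P K) 0 (Matrix.specialUnitaryGroup (Fin 2) ℂ)) (hreg : RegPr F n K ε₀ U₀) :
    ∀ r : PBond (F.P K) 0 → ℝ, ∃ s : PBond (F.P n) 0 → ℝ,
      QTwS F n K h U₀ (fun b => ((r b : ℝ) : ℂ) • (1 : Matrix (Fin 2) (Fin 2) ℂ)) = fun c => ((s c : ℝ) : ℂ) • (1 : Matrix (Fin 2) (Fin 2) ℂ) := by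
  intro r
  refine ⟨fun c => ((F.P K).L : ℝ) ^ (K - n) * bondAvgIter (K - n) r (bondShift (sites_eq F n K h) c), ?_⟩
  rw [QTwS_apply_smul_one_of_regPr F h hε₀ hWε U₀ hreg (fun b => ((r b : ℝ) : ℂ))]
  funext c
  have hre : bondAvgIter (K - n) (fun b => ((r b : ℝ) : ℂ)) (bondShift (sites_eq F n K h) c) =
      ((bondAvgIter (K - n) r (bondShift (sites_eq F n K h) c) : ℝ) : ℂ) :=
    ChartHInv.bondAvgIter_comp_apply Complex.ofRealCLM.toLinearMap (K - n) r _
  rw [hre]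
  push_cast
  rfl

/-- **(J2)-companion on `𝔘_k(ε₀)`**: `QTwS U₀ (c·1) = QTwS 1 (c·1)` — on the centre the averaging operator of a printed-regular background takes its value at `U₀ = 1`
(✓`QTwS_one_apply`). [cite: Balaban1984PropagatorsI, (1.18) p.20; Balaban1985Averaging, (125)-(127) p.36] -/
theorem QTwS_smul_one_eq_QTwS_one_of_regPr {ε₀ : ℝ} (hε₀ : 0 < ε₀) (hWε : 10 ^ 12 * (F.L : ℝ) ^ 3 * ε₀ ≤ 1)
    (U₀ : GaugeField (F.P K) 0 (Matrix.specialUnitaryGroup (Fin 2) ℂ)) (hreg : RegPr F n K ε₀ U₀) (c : PBond (F.P K) 0 → ℂ) :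
    QTwS F n K h U₀ (fun b => c b • (1 : Matrix (Fin 2) (Fin 2) ℂ)) = QTwS F n K h 1 (fun b => c b • (1 : Matrix (Fin 2) (Fin 2) ℂ)) :=
  QTwS_smul_one_eq_QTwS_one_of_central F h U₀ c (QTwS_apply_smul_one_of_regPr F h hε₀ hWε U₀ hreg c)

/-- **`Q(σ(c·1)) = σ(Q(c·1))` on `𝔘_k(ε₀)`** (`σ = star`): the flat average has real coefficients. [cite: Balaban1985Variational, (51) p.286; Balaban1984PropagatorsI, (1.18) p.20] -/
theorem star_QTwS_smul_one_of_regPr {ε₀ : ℝ} (hε₀ : 0 < ε₀) (hWε : 10 ^ 12 * (F.L : ℝ) ^ 3 * ε₀ ≤ 1)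
    (U₀ : GaugeField (F.P K) 0 (Matrix.specialUnitaryGroup (Fin 2) ℂ)) (hreg : RegPr F n K ε₀ U₀) (c : PBond (F.P K) 0 → ℂ) :
    QTwS F n K h U₀ (star (fun b => c b • (1 : Matrix (Fin 2) (Fin 2) ℂ))) = star (QTwS F n K h U₀ (fun b => c b • (1 : Matrix (Fin 2) (Fin 2) ℂ))) :=
  star_QTwS_smul_one_of_central F h U₀ c (QTwS_apply_smul_one_of_regPr F h hε₀ hWε U₀ hreg c)
    (QTwS_apply_smul_one_of_regPr F h hε₀ hWε U₀ hreg fun b => starRingEnd ℂ (c b))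

end T3

end Summit.QuantumFields.YangMills.Theorems.Prop7SymAvgTwSym

end
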